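import Summits.HubbardSuperconductivity.HubbardSuperconductivity.Theses.FunctionFieldCertificate
import Summits.HubbardSuperconductivity.HubbardSuperconductivity.Theorems.FunctionFieldCertificateCertificateCompleteness
import Summits.HubbardSuperconductivity.HubbardSuperconductivity.Theorems.FunctionFieldCertificateCertificateSoundness
import Summits.HubbardSuperconductivity.HubbardSuperconductivity.Theorems.FunctionFieldCertificateMesoscopicPairOrderSplit
import Summits.HubbardSuperconductivity.HubbardSuperconductivity.Theorems.FunctionFieldCertificateMesoscopicPairOrderSeedForms
import HarnessLib

/-!
# `MesoscopicPairOrder` (stmt-HubbardSuperconductivity-7331), line `pointwise_split`: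
# the load-bearing stub (B) in CERTIFICATE language — the route's layer `FiniteRangeCertificate_R`

Support file for the crux (route `FunctionFieldCertificate`, pole-free half; lead c8 of line
`pointwise_split`). The route header foresees the glued split
`MesoscopicPairOrder ⇐ [FiniteRangeCertificate_R: a pole-free certificate of K_R ≥ m R² at FIXED R] →
[R-uniformity of m]`, and the strategist's census records that the only thing stub (B)
`LeakBeatingBlockPairSeed` buys over the crux is SHAPE: one finite-range operator inequality
`K_{R₀} ≥ m₀ R₀² L²` on sector ground states, `L`-uniform, at ONE block scale — the only shape a
finite-range SOS + KKT certificate can state (`fejerBox_mul_antitone`: no finite-range family certifies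
the `∀ R` crux). Here `K_R = Σ_{x,y} W_R(y - x) • (P_xᴴ P_y)` is the Fejér block pair operator
(`W_R(z) = Πᵢ (1 - |zᵢ|_L/R)₊`, `P_x = localPair dWaveFormFactor L x`; `Re⟨ψ, K_R ψ⟩ = T_R(ψ)`,
`stub_boxExpectation`; Hermitian, `isHermitian_boxRepulsion`). This file gives that layer its typed
SEMANTICS, parallel to the landed `CertificateSoundness` (stmt-7333) / `CertificateCompleteness`
(stmt-7334) for the `k = 0` target `CertifiedSectorLRO`:

* §1 `certificate_at_of_observable` — the completeness lemma of stmt-7334 for an ARBITRARY Hermitian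
  observable `M₀` (there: `M₀ = L⁻⁴ Δ_dᴴ Δ_d`): if every normalised `(2n, 0)`-sector ground state of
  `hubbardTorus 2 L 1 U` has `a ≤ Re⟨ψ, M₀ ψ⟩`, then for every slack `s > 0`
  `M₀ - (a - s)·1 = Oᴴ O + Σ_i Q_iᴴ (H Q_i - Q_i H) + (H·0 - 0·H) + T` with sector-preserving `Q_i`
  and a sector term `T` (`exists_certificate_core`).
* §2 `blockMargin_le_of_certificate` — SOUNDNESS at one side: an evaluated certificate for
  `L⁻² K_{R₀} - μ·1` forces `μ ≤ T_{R₀}(ψ)/L²` in every normalised sector ground state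
  (`le_re_of_certificate` + `stub_boxExpectation`).
* §3 `blockCertificate_at` — COMPLETENESS at one side: `μ ≤ T_{R₀}(ψ)/L²` in every normalised
  `(2n, 0)`-sector ground state gives a certificate for `L⁻² K_{R₀} - (μ - s)·1`, every `s > 0`.
* §4 `leakBeatingBlockPairSeed_iff_blockCertified` — **(B) ⟺ (B) with its body replaced by an
  eventual family of evaluated block certificates** for `L⁻² K_{R₀} - (m₀ R₀² - C/L)·1` (slack `C/L`
  as in `CertifiedSectorLRO`; ⇐ shrinks the margin inside the strict leak inequality, ⇒ has `C = 1`).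
  So per-`L` certifiability adds and loses nothing: all content of the foreseen layer is in an
  `L`-UNIFORM (symbol-class, finite-range) presentation of such a family at ONE scale `R₀` — the
  calibration remark of stmt-7334, now for layer 1.
* What ONE such family buys at a point where stub (A)'s profile holds (uniform sector pair order there,
  hence the crux and the summit) is the companion file
  `FunctionFieldCertificateMesoscopicPairOrderBlockCertificateEndgame.lean`.

Folklore finite-dimensional bookkeeping over landed tree lemmas (Tasaki, *Physics and Mathematics of
Quantum Many-Body Systems* (2020) §2.1–2.2 for the variational facts; the "first-order SDP / KKT
completeness" theme is FawziFawziScalet2024, doi:10.1007/s10208-026-09761-x, there asymptotically in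
the degree). No definition, no named fact, no sorry; nothing here claims (A) or (B).
-/

noncomputable section

-- the summit namespace repeats the problem name by design (D-0017)
set_option linter.dupNamespace false

namespace Summit.HubbardSuperconductivity.HubbardSuperconductivity.Theorems.FunctionFieldCertificate

open Matrix Finset Filter
open Literature.Probability.LatticeModels Literature.MathematicalPhysics.QuantumLattice
open Literature.Barriers.HubbardSuperconductivity
open Summit.HubbardSuperconductivity.HubbardSuperconductivity.Theses.FunctionFieldCertificate
open scoped ComplexOrder ComplexConjugate

/-! ### §1 Completeness at one side for an arbitrary Hermitian observable -/

/-- **Certificate at one side for an arbitrary observable.** Let `M₀` be a Hermitian matrix on the Fock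
space of the `L × L` torus and `n ≤ L²`. If every normalised ground state of `hubbardTorus 2 L 1 U` in
the sector `(2n, S^z = 0)` has `a ≤ Re⟨ψ, M₀ ψ⟩`, then for every slack `s > 0`,
`M₀ - (a - s)·1 = Σ Oᴴ O + Σ_i Q_iᴴ (H Q_i - Q_i H) + (H·R - R·H) + T` with sector-preserving `Q_i`,
`R = 0` and a sector term `T` of zero expectation on `szSector (2n) 0`. This is `certificate_at`
(stmt-7334, `M₀ = L⁻⁴ Δ_dᴴ Δ_d`, `s = 1/L`) with the observable abstracted; same proof:
`exists_certificate_core` on Lieb's `(n, n)` coordinate block (`mem_szSector_two_mul_zero_iff`,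
`LiebThm1.hamiltonian_isHermitian`, `LiebThm1.preservesSectors_hamiltonian`, `szSector_groundState`,
`exists_unit_isGroundStateInSector_hubbardTorus`), strict positivity `Re⟨v, (M₀ - (a - s))v⟩ ≥ s > 0`
at unit sector ground states. [folklore] -/
theorem certificate_at_of_observable (U : ℝ) (L : ℕ) [NeZero L] (n : ℕ) (hn : n ≤ L ^ 2)
    (M₀ : Matrix (Finset (Orb (FermionTorus 2 L))) (Finset (Orb (FermionTorus 2 L))) ℂ)
    (hM₀ : M₀.IsHermitian) {a s : ℝ} (hs : 0 < s)
    (hyp : ∀ ψ : Fock (Orb (FermionTorus 2 L)), star ψ ⬝ᵥ ψ = 1 →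
      IsGroundStateInSector (hubbardTorus 2 L 1 U) (2 * n) 0 ψ → a ≤ (star ψ ⬝ᵥ M₀ *ᵥ ψ).re) :
    ∃ (n' m : ℕ)
      (O : Fin n' → Matrix (Finset (Orb (FermionTorus 2 L))) (Finset (Orb (FermionTorus 2 L))) ℂ)
      (Q : Fin m → Matrix (Finset (Orb (FermionTorus 2 L))) (Finset (Orb (FermionTorus 2 L))) ℂ)
      (R T : Matrix (Finset (Orb (FermionTorus 2 L))) (Finset (Orb (FermionTorus 2 L))) ℂ),
      (∀ (i : Fin m) (ψ : Fock (Orb (FermionTorus 2 L))), ψ ∈ szSector (2 * n) 0 →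
        Q i *ᵥ ψ ∈ szSector (2 * n) 0) ∧
      (∀ ψ : Fock (Orb (FermionTorus 2 L)), ψ ∈ szSector (2 * n) 0 → star ψ ⬝ᵥ T *ᵥ ψ = 0) ∧
      M₀ - ((a - s : ℝ) : ℂ) •
            (1 : Matrix (Finset (Orb (FermionTorus 2 L))) (Finset (Orb (FermionTorus 2 L))) ℂ) =
        ∑ i : Fin n', (O i)ᴴ * O i +
          ∑ i : Fin m, (Q i)ᴴ * (hubbardTorus 2 L 1 U * Q i - Q i * hubbardTorus 2 L 1 U) +
          (hubbardTorus 2 L 1 U * R - R * hubbardTorus 2 L 1 U) + T := by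
  set H := hubbardTorus 2 L 1 U with hH_def
  set M := M₀ - ((a - s : ℝ) : ℂ) •
      (1 : Matrix (Finset (Orb (FermionTorus 2 L))) (Finset (Orb (FermionTorus 2 L))) ℂ) with hM_def
  set p : Finset (Orb (FermionTorus 2 L)) → Prop := fun s => (upPart s).card = n ∧ (downPart s).card = n
    with hp_def
  -- tree facts: Hermitian, block diagonal, sector = Lieb's `(n, n)` block, variational bound, a GS
  have hHerm : H.IsHermitian := LiebThm1.hamiltonian_isHermitian (fermionTorusGraph 2 L) 1 U
  have hPres : PreservesSectors H := LiebThm1.preservesSectors_hamiltonian (fermionTorusGraph 2 L) 1 U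
  have hK : ∀ v : Fock (Orb (FermionTorus 2 L)), v ∈ szSector (2 * n) (0 : ℝ) ↔ IsInSector n n v :=
    fun v => mem_szSector_two_mul_zero_iff n v
  have hcard : n ≤ Fintype.card (FermionTorus 2 L) := by
    simpa [FermionTorus, Fintype.card_fin] using hn
  obtain ⟨-, hvar⟩ := szSector_groundState (fermionTorusGraph 2 L) 1 U hcard
  obtain ⟨u, hu1, hu⟩ := exists_unit_isGroundStateInSector_hubbardTorus U L n hn
  -- the hypotheses of the core lemma
  have hM : M.IsHermitian := by
    refine hM₀.sub ?_
    rw [IsHermitian, conjTranspose_smul, conjTranspose_one, Complex.star_def, Complex.conj_ofReal]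
  have hinv : ∀ v : Fock (Orb (FermionTorus 2 L)), IsInSector n n v → IsInSector n n (H *ᵥ v) :=
    fun v hv => hPres.isInSector_mulVec hv
  have hE : ∀ v : Fock (Orb (FermionTorus 2 L)), IsInSector n n v →
      H.minEnergyOn (szSector (2 * n) 0) * (star v ⬝ᵥ v).re ≤ (star v ⬝ᵥ H *ᵥ v).re :=
    fun v hv => hvar v hv
  have hpos : ∀ v : Fock (Orb (FermionTorus 2 L)), IsInSector n n v → star v ⬝ᵥ v = 1 →
      H *ᵥ v = ((H.minEnergyOn (szSector (2 * n) 0) : ℝ) : ℂ) • v → 0 < (star v ⬝ᵥ M *ᵥ v).re := by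
    intro v hv hv1 hHv
    have hv0 : v ≠ 0 := by
      intro h0
      rw [h0, dotProduct_zero] at hv1
      exact zero_ne_one hv1
    have ha := hyp v hv1 ⟨(hK v).2 hv, hv0, hHv⟩
    have hform : (star v ⬝ᵥ M *ᵥ v).re = (star v ⬝ᵥ M₀ *ᵥ v).re - (a - s) := by
      rw [hM_def, sub_mulVec, smul_mulVec, one_mulVec, dotProduct_sub, dotProduct_smul, hv1,
        smul_eq_mul, mul_one, Complex.sub_re, Complex.ofReal_re]
    rw [hform]
    linarith
  obtain ⟨O, T, c, hc, hT, hid⟩ :=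
    exists_certificate_core p H M hHerm hM hinv _ hE hpos u hu1 hu.2.2
  -- re-indexing the KKT generators by `Fin m`
  set w : Fock (Orb (FermionTorus 2 L)) := ((Real.sqrt c : ℝ) : ℂ) • u with hw_def
  set e := Fintype.equivFin (Finset (Orb (FermionTorus 2 L))) with he_def
  have hsum : ∑ i : Fin (Fintype.card (Finset (Orb (FermionTorus 2 L)))),
      (vecMulVec w (Pi.single (e.symm i) 1))ᴴ *
        (H * vecMulVec w (Pi.single (e.symm i) 1) - vecMulVec w (Pi.single (e.symm i) 1) * H) =
      ∑ j : Finset (Orb (FermionTorus 2 L)), (vecMulVec w (Pi.single j 1))ᴴ *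
        (H * vecMulVec w (Pi.single j 1) - vecMulVec w (Pi.single j 1) * H) :=
    Equiv.sum_comp e.symm (fun j => (vecMulVec w (Pi.single j 1))ᴴ *
        (H * vecMulVec w (Pi.single j 1) - vecMulVec w (Pi.single j 1) * H))
  refine ⟨1, Fintype.card (Finset (Orb (FermionTorus 2 L))), fun _ => O,
    fun i => vecMulVec w (Pi.single (e.symm i) 1), 0, T, ?_, ?_, ?_⟩
  · intro i ψ _
    rw [vecMulVec_mulVec, op_smul_eq_smul]
    exact Submodule.smul_mem _ _ (Submodule.smul_mem _ _ hu.1)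
  · intro ψ hψ
    exact hT ψ ((hK ψ).1 hψ)
  · rw [Fin.sum_univ_one, hsum, Matrix.mul_zero, Matrix.zero_mul, sub_zero, add_zero]
    exact hid

/-! ### §2 Soundness of an evaluated block certificate -/

/-- The scaled block expectation: `Re⟨ψ, (L⁻² • K_R) ψ⟩ = T_R(ψ)/L²` (`stub_boxExpectation`). [folklore] -/
theorem re_expect_smul_boxRepulsion (L : ℕ) [NeZero L] (R : ℕ) (ψ : Fock (Orb (FermionTorus 2 L))) :
    (star ψ ⬝ᵥ ((1 / (L : ℂ) ^ 2) • (∑ x : TorusSite 2 L, ∑ y : TorusSite 2 L,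
        ((∏ i : Fin 2, max 0 (1 - |(((y i - x i).valMinAbs : ℤ) : ℝ)| / (R : ℝ)) : ℝ) : ℂ) •
          ((localPair dWaveFormFactor L x)ᴴ * localPair dWaveFormFactor L y))) *ᵥ ψ).re =
      (∑ x : TorusSite 2 L, ∑ y : TorusSite 2 L,
        (∏ i : Fin 2, max 0 (1 - |(((y i - x i).valMinAbs : ℤ) : ℝ)| / (R : ℝ))) *
          (star (localPair dWaveFormFactor L x *ᵥ ψ) ⬝ᵥ (localPair dWaveFormFactor L y *ᵥ ψ)).re) /
        (L : ℝ) ^ 2 := by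
  have hcoe : (1 / (L : ℂ) ^ 2) = (((1 / (L : ℝ) ^ 2 : ℝ)) : ℂ) := by push_cast; rfl
  rw [smul_mulVec, dotProduct_smul, smul_eq_mul, hcoe, Complex.re_ofReal_mul,
    stub_boxExpectation L R ψ, one_div_mul_eq_div]

/-- **SOUNDNESS at one side.** If `L⁻² • K_{R₀} - μ • 1 = Σ Oᴴ O + Σ_i Q_iᴴ (H Q_i - Q_i H) + (H R - R H) + T`
with `H = hubbardTorus 2 L 1 U`, `Q_i` preserving the sector `szSector N 0` and `T` of zero expectation
there, then every normalised ground state `ψ` of that sector has `μ ≤ T_{R₀}(ψ)/L²`: the block version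
of `le_re_of_certificate` (‖Oψ‖² ≥ 0; ⟨Qψ,(H - E₀)Qψ⟩ ≥ 0 by the variational principle in the sector;
⟨ψ,[H,R]ψ⟩ = 0 at an eigenvector; ⟨ψ,Tψ⟩ = 0), read through `Re⟨ψ, K_R ψ⟩ = T_R(ψ)`.
Tasaki (2020) §2.1–2.2. [folklore] -/
theorem blockMargin_le_of_certificate {U : ℝ} {L : ℕ} [NeZero L] {N : ℕ} (R₀ : ℕ) {μ : ℝ}
    {n m : ℕ}
    (O : Fin n → Matrix (Finset (Orb (FermionTorus 2 L))) (Finset (Orb (FermionTorus 2 L))) ℂ)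
    (Q : Fin m → Matrix (Finset (Orb (FermionTorus 2 L))) (Finset (Orb (FermionTorus 2 L))) ℂ)
    (R T : Matrix (Finset (Orb (FermionTorus 2 L))) (Finset (Orb (FermionTorus 2 L))) ℂ)
    (hQ : ∀ (i : Fin m) (φ : Fock (Orb (FermionTorus 2 L))), φ ∈ szSector N 0 → Q i *ᵥ φ ∈ szSector N 0)
    (hT : ∀ φ : Fock (Orb (FermionTorus 2 L)), φ ∈ szSector N 0 → star φ ⬝ᵥ T *ᵥ φ = 0)
    (hId : (1 / (L : ℂ) ^ 2) • (∑ x : TorusSite 2 L, ∑ y : TorusSite 2 L,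
        ((∏ i : Fin 2, max 0 (1 - |(((y i - x i).valMinAbs : ℤ) : ℝ)| / (R₀ : ℝ)) : ℝ) : ℂ) •
          ((localPair dWaveFormFactor L x)ᴴ * localPair dWaveFormFactor L y)) -
        (μ : ℂ) • (1 : Matrix (Finset (Orb (FermionTorus 2 L))) (Finset (Orb (FermionTorus 2 L))) ℂ) =
      ∑ i, (O i)ᴴ * O i + ∑ i, (Q i)ᴴ * (hubbardTorus 2 L 1 U * Q i - Q i * hubbardTorus 2 L 1 U) +
        (hubbardTorus 2 L 1 U * R - R * hubbardTorus 2 L 1 U) + T)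
    {ψ : Fock (Orb (FermionTorus 2 L))} (hψ1 : star ψ ⬝ᵥ ψ = 1)
    (hgs : IsGroundStateInSector (hubbardTorus 2 L 1 U) N 0 ψ) :
    μ ≤ (∑ x : TorusSite 2 L, ∑ y : TorusSite 2 L,
        (∏ i : Fin 2, max 0 (1 - |(((y i - x i).valMinAbs : ℤ) : ℝ)| / (R₀ : ℝ))) *
          (star (localPair dWaveFormFactor L x *ᵥ ψ) ⬝ᵥ (localPair dWaveFormFactor L y *ᵥ ψ)).re) /
        (L : ℝ) ^ 2 := by
  classical
  have hH : (hubbardTorus 2 L 1 U).IsHermitian := LiebThm1.hamiltonian_isHermitian _ 1 U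
  obtain ⟨hψK, -, hHψ⟩ := hgs
  have h := le_re_of_certificate hH _ _ _ μ O Q R T hQ hT hId hψK hψ1 hHψ
  have hcoe : (1 / (L : ℂ) ^ 2) = (((1 / (L : ℝ) ^ 2 : ℝ)) : ℂ) := by push_cast; rfl
  rwa [hcoe, Complex.re_ofReal_mul, stub_boxExpectation L R₀ ψ, one_div_mul_eq_div] at h

/-! ### §3 Completeness at one side for the block functional -/

/-- **COMPLETENESS at one side.** If every normalised ground state of `hubbardTorus 2 L 1 U` in the sector
`(2n, 0)` (`n ≤ L²`) has `μ ≤ T_{R₀}(ψ)/L²`, then for every slack `s > 0` there is an evaluated block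
certificate `L⁻² • K_{R₀} - (μ - s) • 1 = Σ Oᴴ O + Σ_i Q_iᴴ (H Q_i - Q_i H) + (H R - R H) + T`
(`certificate_at_of_observable` for the Hermitian `L⁻² • K_{R₀}`, `isHermitian_boxRepulsion`). [folklore] -/
theorem blockCertificate_at (U : ℝ) (L : ℕ) [NeZero L] (n : ℕ) (hn : n ≤ L ^ 2) (R₀ : ℕ) {μ s : ℝ}
    (hs : 0 < s)
    (hyp : ∀ ψ : Fock (Orb (FermionTorus 2 L)), star ψ ⬝ᵥ ψ = 1 →
      IsGroundStateInSector (hubbardTorus 2 L 1 U) (2 * n) 0 ψ →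
        μ ≤ (∑ x : TorusSite 2 L, ∑ y : TorusSite 2 L,
          (∏ i : Fin 2, max 0 (1 - |(((y i - x i).valMinAbs : ℤ) : ℝ)| / (R₀ : ℝ))) *
            (star (localPair dWaveFormFactor L x *ᵥ ψ) ⬝ᵥ (localPair dWaveFormFactor L y *ᵥ ψ)).re) /
          (L : ℝ) ^ 2) :
    ∃ (n' m : ℕ)
      (O : Fin n' → Matrix (Finset (Orb (FermionTorus 2 L))) (Finset (Orb (FermionTorus 2 L))) ℂ)
      (Q : Fin m → Matrix (Finset (Orb (FermionTorus 2 L))) (Finset (Orb (FermionTorus 2 L))) ℂ)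
      (R T : Matrix (Finset (Orb (FermionTorus 2 L))) (Finset (Orb (FermionTorus 2 L))) ℂ),
      (∀ (i : Fin m) (ψ : Fock (Orb (FermionTorus 2 L))), ψ ∈ szSector (2 * n) 0 →
        Q i *ᵥ ψ ∈ szSector (2 * n) 0) ∧
      (∀ ψ : Fock (Orb (FermionTorus 2 L)), ψ ∈ szSector (2 * n) 0 → star ψ ⬝ᵥ T *ᵥ ψ = 0) ∧
      (1 / (L : ℂ) ^ 2) • (∑ x : TorusSite 2 L, ∑ y : TorusSite 2 L,
          ((∏ i : Fin 2, max 0 (1 - |(((y i - x i).valMinAbs : ℤ) : ℝ)| / (R₀ : ℝ)) : ℝ) : ℂ) •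
            ((localPair dWaveFormFactor L x)ᴴ * localPair dWaveFormFactor L y)) -
          ((μ - s : ℝ) : ℂ) •
            (1 : Matrix (Finset (Orb (FermionTorus 2 L))) (Finset (Orb (FermionTorus 2 L))) ℂ) =
        ∑ i : Fin n', (O i)ᴴ * O i +
          ∑ i : Fin m, (Q i)ᴴ * (hubbardTorus 2 L 1 U * Q i - Q i * hubbardTorus 2 L 1 U) +
          (hubbardTorus 2 L 1 U * R - R * hubbardTorus 2 L 1 U) + T := by
  have hcoe : (1 / (L : ℂ) ^ 2) = (((1 / (L : ℝ) ^ 2 : ℝ)) : ℂ) := by push_cast; rfl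
  refine certificate_at_of_observable U L n hn _ ?_ hs fun ψ hψ1 hgs => ?_
  · refine (isHermitian_boxRepulsion R₀).smul ?_
    rw [hcoe]
    exact Complex.conj_ofReal _
  · rw [re_expect_smul_boxRepulsion]
    exact hyp ψ hψ1 hgs

/-! ### §4 Stub (B) in certificate language -/

/-- **(B) ⟺ (B) CERTIFIED PER SIDE.** The load-bearing stub `LeakBeatingBlockPairSeed` of line
`pointwise_split` (left, verbatim) is equivalent to the statement obtained by replacing its body — Fejér
block pair order `m₀ R₀² ≤ T_{R₀}(ψ)/L²` in every normalised `(N_L, 0)`-sector ground state — by an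
eventual family of EVALUATED BLOCK CERTIFICATES: for some constant `C` and all even `L ≥ L₀`,
`L⁻² • K_{R₀} - (m₀ R₀² - C/L) • 1 = Σ Oᴴ O + Σ_i Q_iᴴ (H_L Q_i - Q_i H_L) + (H_L R - R H_L) + T` with
sector-preserving `Q_i` and a sector term `T` (the block analogue of `CertifiedSectorLRO`, at ONE scale).
(⇒) completeness per side with `C = 1` (`blockCertificate_at`, slack `1/L`); (⇐) soundness per side
(`blockMargin_le_of_certificate`) gives the margin `m₀ R₀² - C/L`, and the slack is absorbed by the STRICT
leak inequality: with `a = (m₀ - leak)/2` the margin `m₀ - a` still beats the leak and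
`C/L ≤ a R₀²` for `L ≥ ⌈|C|/(a R₀²)⌉`. So the foreseen layer `FiniteRangeCertificate_R` of the route,
read per side, IS stub (B): all of its content lies in an `L`-UNIFORM (finite-range, symbol-class)
presentation of such a family. [folklore] -/
theorem leakBeatingBlockPairSeed_iff_blockCertified :
    (∃ U : ℝ, 0 < U ∧ ∃ δ ∈ Set.Ioo (0:ℝ) (1 / 2), ∀ S A : ℝ, 0 ≤ S → 0 ≤ A →
      ∃ (R₀ : ℕ) (ε m₀ : ℝ), 0 < R₀ ∧ 0 < ε ∧
        32 * ε * (S * ε + A) + (S + A / ε) / (R₀ : ℝ) ^ 2 < m₀ ∧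
        ∃ L₀ : ℕ, ∀ (L : ℕ) [NeZero L], L₀ ≤ L → Even L →
          ∀ ψ : Fock (Orb (FermionTorus 2 L)), star ψ ⬝ᵥ ψ = 1 →
            IsGroundStateInSector (hubbardTorus 2 L 1 U) (2 * ⌊(1 - δ) * (L : ℝ) ^ 2 / 2⌋₊) 0 ψ →
              m₀ * (R₀ : ℝ) ^ 2 ≤ (∑ x : Fin 2 → ZMod L, ∑ y : Fin 2 → ZMod L,
                (∏ i : Fin 2, max 0 (1 - |(((y i - x i).valMinAbs : ℤ) : ℝ)| / (R₀ : ℝ))) *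
                  (star (Matrix.mulVec (localPair dWaveFormFactor L x) ψ) ⬝ᵥ
                    Matrix.mulVec (localPair dWaveFormFactor L y) ψ).re) / (L : ℝ) ^ 2) ↔
    (∃ U : ℝ, 0 < U ∧ ∃ δ ∈ Set.Ioo (0:ℝ) (1 / 2), ∀ S A : ℝ, 0 ≤ S → 0 ≤ A →
      ∃ (R₀ : ℕ) (ε m₀ : ℝ), 0 < R₀ ∧ 0 < ε ∧
        32 * ε * (S * ε + A) + (S + A / ε) / (R₀ : ℝ) ^ 2 < m₀ ∧
        ∃ (C : ℝ) (L₀ : ℕ), ∀ (L : ℕ) [NeZero L], L₀ ≤ L → Even L →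
          ∃ (n m : ℕ)
            (O : Fin n → Matrix (Finset (Orb (FermionTorus 2 L))) (Finset (Orb (FermionTorus 2 L))) ℂ)
            (Q : Fin m → Matrix (Finset (Orb (FermionTorus 2 L))) (Finset (Orb (FermionTorus 2 L))) ℂ)
            (R T : Matrix (Finset (Orb (FermionTorus 2 L))) (Finset (Orb (FermionTorus 2 L))) ℂ),
            (∀ (i : Fin m) (ψ : Fock (Orb (FermionTorus 2 L))),
              ψ ∈ szSector (2 * ⌊(1 - δ) * (L : ℝ) ^ 2 / 2⌋₊) 0 →
                Q i *ᵥ ψ ∈ szSector (2 * ⌊(1 - δ) * (L : ℝ) ^ 2 / 2⌋₊) 0) ∧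
            (∀ ψ : Fock (Orb (FermionTorus 2 L)),
              ψ ∈ szSector (2 * ⌊(1 - δ) * (L : ℝ) ^ 2 / 2⌋₊) 0 → star ψ ⬝ᵥ T *ᵥ ψ = 0) ∧
            (1 / (L : ℂ) ^ 2) • (∑ x : TorusSite 2 L, ∑ y : TorusSite 2 L,
                ((∏ i : Fin 2, max 0 (1 - |(((y i - x i).valMinAbs : ℤ) : ℝ)| / (R₀ : ℝ)) : ℝ) : ℂ) •
                  ((localPair dWaveFormFactor L x)ᴴ * localPair dWaveFormFactor L y)) -
                ((m₀ * (R₀ : ℝ) ^ 2 - C / (L : ℝ) : ℝ) : ℂ) •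
                  (1 : Matrix (Finset (Orb (FermionTorus 2 L))) (Finset (Orb (FermionTorus 2 L))) ℂ) =
              ∑ i : Fin n, (O i)ᴴ * O i +
                ∑ i : Fin m, (Q i)ᴴ * (hubbardTorus 2 L 1 U * Q i - Q i * hubbardTorus 2 L 1 U) +
                (hubbardTorus 2 L 1 U * R - R * hubbardTorus 2 L 1 U) + T) := by
  constructor
  · rintro ⟨U, hU, δ, hδ, hB⟩
    refine ⟨U, hU, δ, hδ, fun S A hS hA => ?_⟩
    obtain ⟨R₀, ε, m₀, hR₀, hε, hleak, L₀, hseed⟩ := hB S A hS hA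
    refine ⟨R₀, ε, m₀, hR₀, hε, hleak, 1, L₀, fun L _ hL hE => ?_⟩
    have hLpos : (0 : ℝ) < L := Nat.cast_pos.2 (Nat.pos_of_ne_zero (NeZero.ne L))
    exact blockCertificate_at U L _ (natFloor_filling_le_sq (by linarith [hδ.1]) L) R₀
      (by positivity : (0 : ℝ) < 1 / (L : ℝ)) fun ψ hψ1 hgs => hseed L hL hE ψ hψ1 hgs
  · rintro ⟨U, hU, δ, hδ, hC⟩
    refine ⟨U, hU, δ, hδ, fun S A hS hA => ?_⟩
    obtain ⟨R₀, ε, m₀, hR₀, hε, hleak, C, L₀, hcert⟩ := hC S A hS hA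
    -- half the room between the leak and the margin absorbs the slack `C/L`
    set a : ℝ := (m₀ - (32 * ε * (S * ε + A) + (S + A / ε) / (R₀ : ℝ) ^ 2)) / 2 with ha_def
    have ha : 0 < a := by rw [ha_def]; linarith
    have hRpos : (0 : ℝ) < R₀ := Nat.cast_pos.2 hR₀
    have haR : 0 < a * (R₀ : ℝ) ^ 2 := by positivity
    refine ⟨R₀, ε, m₀ - a, hR₀, hε, by rw [ha_def]; linarith, max L₀ ⌈|C| / (a * (R₀ : ℝ) ^ 2)⌉₊,
      fun L _ hL hE ψ hψ1 hgs => ?_⟩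
    obtain ⟨n, m, O, Q, R, T, hQ, hT, hId⟩ := hcert L (le_of_max_le_left hL) hE
    have hsound := blockMargin_le_of_certificate R₀ O Q R T hQ hT hId hψ1 hgs
    have hLpos : (0 : ℝ) < L := Nat.cast_pos.2 (Nat.pos_of_ne_zero (NeZero.ne L))
    -- `C/L ≤ a R₀²`
    have hCL : C / (L : ℝ) ≤ a * (R₀ : ℝ) ^ 2 := by
      have h1 : ((⌈|C| / (a * (R₀ : ℝ) ^ 2)⌉₊ : ℕ) : ℝ) ≤ (L : ℝ) := by
        exact_mod_cast le_of_max_le_right hL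
      have h2 : |C| / (a * (R₀ : ℝ) ^ 2) ≤ (L : ℝ) := (Nat.le_ceil _).trans h1
      rw [div_le_iff₀ haR] at h2
      rw [div_le_iff₀ hLpos]
      calc C ≤ |C| := le_abs_self C
        _ ≤ (L : ℝ) * (a * (R₀ : ℝ) ^ 2) := h2
        _ = a * (R₀ : ℝ) ^ 2 * (L : ℝ) := by ring
    calc (m₀ - a) * (R₀ : ℝ) ^ 2 = m₀ * (R₀ : ℝ) ^ 2 - a * (R₀ : ℝ) ^ 2 := by ring
      _ ≤ m₀ * (R₀ : ℝ) ^ 2 - C / (L : ℝ) := by linarith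
      _ ≤ _ := hsound

/-- **Registered form** (`leakBeatingBlockPairSeedIffBlockCertified`, sub-goal of stmt-7331): stub (B) of
line `pointwise_split` ⟺ its per-side certified form, one-line verbatim signature. [folklore] -/
theorem leakBeatingBlockPairSeedIffBlockCertified : (∃ U : ℝ, 0 < U ∧ ∃ δ ∈ Set.Ioo (0:ℝ) (1 / 2), ∀ S A : ℝ, 0 ≤ S → 0 ≤ A → ∃ (R₀ : ℕ) (ε m₀ : ℝ), 0 < R₀ ∧ 0 < ε ∧ 32 * ε * (S * ε + A) + (S + A / ε) / (R₀ : ℝ) ^ 2 < m₀ ∧ ∃ L₀ : ℕ, ∀ (L : ℕ) [NeZero L], L₀ ≤ L → Even L → ∀ ψ : Fock (Orb (FermionTorus 2 L)), star ψ ⬝ᵥ ψ = 1 → IsGroundStateInSector (hubbardTorus 2 L 1 U) (2 * ⌊(1 - δ) * (L : ℝ) ^ 2 / 2⌋₊) 0 ψ → m₀ * (R₀ : ℝ) ^ 2 ≤ (∑ x : Fin 2 → ZMod L, ∑ y : Fin 2 → ZMod L, (∏ i : Fin 2, max 0 (1 - |(((y i - x i).valMinAbs : ℤ) : ℝ)|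 / (R₀ : ℝ))) * (star (Matrix.mulVec (localPair dWaveFormFactor L x) ψ) ⬝ᵥ Matrix.mulVec (localPair dWaveFormFactor L y) ψ).re) / (L : ℝ) ^ 2) ↔ (∃ U : ℝ, 0 < U ∧ ∃ δ ∈ Set.Ioo (0:ℝ) (1 / 2), ∀ S A : ℝ, 0 ≤ S → 0 ≤ A → ∃ (R₀ : ℕ) (ε m₀ : ℝ), 0 < R₀ ∧ 0 < ε ∧ 32 * ε * (S * ε + A) + (S + A / ε) / (R₀ : ℝ) ^ 2 < m₀ ∧ ∃ (C : ℝ) (L₀ : ℕ), ∀ (L : ℕ) [NeZero L], L₀ ≤ L → Even L → ∃ (n m : ℕ) (O : Fin n → Matrix (Finset (Orb (FermionTorus 2 L))) (Finset (Orb (FermionTorus 2 L))) ℂ) (Q : Fin m → Matrix (Finset (Orb (FermionTorus 2 L))) (Finset (Orb (FermionTorus 2 L))) ℂ) (R T : Matrix (Finset (Orb (FermionTorus 2 L))) (Finset (Orb (FermionTorus 2 L))) ℂ), (∀ (i : Fin m) (ψ : Fock (Orb (FermionTorus 2 L))), ψ ∈ szSector (2 * ⌊(1 - δ) * (L : ℝ)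 ^ 2 / 2⌋₊) 0 → Q i *ᵥ ψ ∈ szSector (2 * ⌊(1 - δ) * (L : ℝ) ^ 2 / 2⌋₊) 0) ∧ (∀ ψ : Fock (Orb (FermionTorus 2 L)), ψ ∈ szSector (2 * ⌊(1 - δ) * (L : ℝ) ^ 2 / 2⌋₊) 0 → star ψ ⬝ᵥ T *ᵥ ψ = 0) ∧ (1 / (L : ℂ) ^ 2) • (∑ x : TorusSite 2 L, ∑ y : TorusSite 2 L, ((∏ i : Fin 2, max 0 (1 - |(((y i - x i).valMinAbs : ℤ) : ℝ)| / (R₀ : ℝ)) : ℝ) : ℂ) • ((localPair dWaveFormFactor L x)ᴴ * localPair dWaveFormFactor L y)) - ((m₀ * (R₀ : ℝ) ^ 2 - C / (L : ℝ) : ℝ) : ℂ) • (1 : Matrix (Finset (Orb (FermionTorus 2 L))) (Finset (Orb (FermionTorus 2 L))) ℂ) = ∑ i : Fin n, (O i)ᴴ * O i + ∑ i : Fin m, (Q i)ᴴ * (hubbardTorus 2 L 1 U * Q i - Q i * hubbardTorus 2 L 1 U) + (hubbardTorus 2 L 1 U * R - R * hubbardTorus 2 L 1 U) + T) :=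
  leakBeatingBlockPairSeed_iff_blockCertified

end Summit.HubbardSuperconductivity.HubbardSuperconductivity.Theorems.FunctionFieldCertificate
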